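import Mathlib.Analysis.RCLike.Basic
import Literature.MathematicalPhysics.QuantumLattice.GrassmannEffectiveAction
import HarnessLib

/-!
# Kernels of Grassmann polynomials and Salmhofer's `L¹–L^∞` kernel norms

Topic `MathematicalPhysics/QuantumLattice`; generic layer (part 3) under the definition request
`defn-hubbardEffectiveAction`.  An element `F` of the Grassmann algebra on the finite label set
`Γ` is uniquely `F = Σ_m Σ_{X ∈ Γ^m} F_m(X_1,…,X_m) ψ(X_1)⋯ψ(X_m)` with totally antisymmetric
coefficient functions ("kernels") `F_m` w.r.t. the PLAIN sum over labels; Salmhofer writes the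
same expansion w.r.t. the weighted measure `∫ dX = ε_Γ Σ_X`,
`F = Σ_m ∫_{Γ^m} dX G_m(X) ψ(X_1)⋯ψ(X_m)`, so that his kernels are `G_m = ε_Γ^{-m} F_m`
(Salmhofer 1998, (3.12); Salmhofer 1999, (4.95) — there for Wick-ordered monomials, here for plain
ones), and the renormalization group bounds are stated in the norm
`‖G_m‖ = max_p sup_{X_p} ∫ ∏_{q ≠ p} dX_q |G_m(X_1,…,X_m)|` (Salmhofer 1998, §4.1, the norm of
[GK] = Gawȩdzki–Kupiainen).

## Contents

* `iterDeriv R X = ∂_{X_{m-1}} ⋯ ∂_{X_0}` and `kernel R F m X = (m!)⁻¹ constPart (iterDeriv X F)`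
  — basis-free extraction of the plain-sum antisymmetric kernels `F_m` (on `ψ(X_0)⋯ψ(X_{m-1})`
  with distinct labels `iterDeriv X` gives `1`; the `m!` accounts for the `m!` orderings of an
  antisymmetric kernel; the plain derivative `∂_X ψ(Y) = δ_{XY}` is `ε_Γ` times Salmhofer's
  `δ/δψ(X)`); `kernel_zero`, `kernel_add`, `kernel_smul`, `kernel_gen`.
* `weightedKernel ε F m = ε^{-m} • kernel F m` — Salmhofer's kernel `G_m` w.r.t. `∫ dX = ε Σ_X`.
* `kernelNorm ε m K` — the `L¹–L^∞` norm of an `m`-point function with integration weight `ε`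
  (Salmhofer 1998, §4.1): for `m = 0` the modulus of the constant, for `m ≥ 1` the maximum over
  the distinguished argument `p` and its value `X_p` of `ε^{m-1} Σ_{(X_q)_{q≠p}} ‖K X‖`.
* `actionNorm w ε F = Σ_{m ≤ |Γ|} w m · ‖G_m‖`, `G_m = weightedKernel ε F m` — the weighted sum over
  the degree of Salmhofer's norms of Salmhofer's kernels, with user-supplied weights `w` (e.g.
  `w m = hᵐ`; Theorem 1 of Salmhofer 1998 bounds `‖G_{m,r}(t)‖ ≤ γ_{mr} e^{t(m/2-2)}` for `m ≥ 6`,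
  so the normalising weight at scale `t` is `w m = e^{-t(m/2-2)}`); degrees `m > |Γ|` carry no
  monomials.

## Sources

M. Salmhofer, Commun. Math. Phys. 194 (1998) 249, §3.2 (3.12) (kernel expansion), §4.1 (the
norm `‖F_m‖`, Lemma 1) (arXiv:cond-mat/9706188 pp. 11, 14 of the held text); bib key
`Salmhofer1998`.  M. Salmhofer, *Renormalization* (1999), (4.95), (4.140), (4.151); bib key
`Salmhofer1999`.

## Design

Kernels are over any commutative `ℚ`-algebra `R`; norms over `𝕜 = ℝ` or `ℂ` (`RCLike 𝕜`).
The norms are plain real numbers (finite maxima written as `⨆` over finite index types); no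
analytic property is claimed here.
-/

noncomputable section

namespace Literature.MathematicalPhysics.QuantumLattice

open GrassmannAlgebra

/-! ### Kernels (coefficient functions) -/

section Kernels

variable (R : Type*) [CommRing R] [Algebra ℚ R] {Γ : Type*}

/-- The iterated derivative `∂_{X_{m-1}} ⋯ ∂_{X_1} ∂_{X_0}` (applied in this order, `∂_{X_0}`
first), so that on `ψ(X_0) ψ(X_1) ⋯ ψ(X_{m-1})` with distinct labels it gives `1`. [folklore] -/
def iterDeriv {m : ℕ} (X : Fin m → Γ) : Module.End R (GrassmannAlgebra R Γ) :=
  ((List.ofFn fun i => grassmannDeriv R (X i)).reverse).prod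

/-- The **`m`-point kernel** (totally antisymmetric coefficient function w.r.t. the plain sum over
labels) of `F`: `kernel F m (X_0,…,X_{m-1}) = (m!)⁻¹ · constPart (∂_{X_{m-1}} ⋯ ∂_{X_0} F)`, so that
`F = Σ_m Σ_X kernel F m X · ψ(X_0)⋯ψ(X_{m-1})`.  Salmhofer's kernel w.r.t. `∫ dX = ε_Γ Σ_X`
(Salmhofer 1998, (3.12); Salmhofer 1999, (4.95), there with Wick-ordered monomials) is
`ε_Γ^{-m} · kernel F m` (`weightedKernel`). [folklore] -/
def kernel (F : GrassmannAlgebra R Γ) (m : ℕ) (X : Fin m → Γ) : R :=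
  ((m.factorial : ℚ)⁻¹ • (1 : R)) * constPart R (iterDeriv R X F)

/-- Unfolding `kernel`. [folklore] -/
theorem kernel_def (F : GrassmannAlgebra R Γ) (m : ℕ) (X : Fin m → Γ) :
    kernel R F m X = ((m.factorial : ℚ)⁻¹ • (1 : R)) * constPart R (iterDeriv R X F) := rfl

/-- The `0`-point kernel is the constant part. [folklore] -/
theorem kernel_zero (F : GrassmannAlgebra R Γ) (X : Fin 0 → Γ) : kernel R F 0 X = constPart R F := by
  simp [kernel, iterDeriv]

/-- Kernels are linear in `F`. [folklore] -/
theorem kernel_add (F G : GrassmannAlgebra R Γ) (m : ℕ) (X : Fin m → Γ) :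
    kernel R (F + G) m X = kernel R F m X + kernel R G m X := by
  simp only [kernel, map_add, mul_add]

/-- Kernels are homogeneous in `F`. [folklore] -/
theorem kernel_smul (r : R) (F : GrassmannAlgebra R Γ) (m : ℕ) (X : Fin m → Γ) :
    kernel R (r • F) m X = r * kernel R F m X := by
  simp only [kernel, map_smul, smul_eq_mul]
  ring

/-- The zero polynomial has zero kernels. [folklore] -/
@[simp] theorem kernel_zero_right (m : ℕ) (X : Fin m → Γ) : kernel R (0 : GrassmannAlgebra R Γ) m X = 0 := by
  simp only [kernel, map_zero, mul_zero]

/-- The one-point kernel of a generator: `kernel ψ(Y) 1 (X) = δ_{XY}`. [folklore] -/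
theorem kernel_gen [DecidableEq Γ] (X Y : Γ) : kernel R (gen R Y) 1 (fun _ => X) = if X = Y then 1 else 0 := by
  simp only [kernel, iterDeriv, List.ofFn_succ, List.ofFn_zero, List.reverse_singleton,
    List.prod_singleton, grassmannDeriv_gen, Nat.factorial_one, Nat.cast_one, inv_one, one_smul, one_mul]
  split_ifs <;> simp

end Kernels

/-! ### Salmhofer's `L¹–L^∞` norm of an `m`-point function and weighted action norms -/

section Norms

variable {𝕜 : Type*} [RCLike 𝕜] {Γ : Type*} [Fintype Γ] [DecidableEq Γ]

/-- **Salmhofer's `L¹–L^∞` kernel norm** with integration weight `ε` (`∫ dX = ε Σ_X`):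
`‖K‖ = max_{p} sup_{X_p} ∫ ∏_{q ≠ p} dX_q |K(X_0,…,X_{m-1})|` for `m ≥ 1`
(Salmhofer 1998, §4.1, the norm of Gawȩdzki–Kupiainen; Salmhofer 1999, (4.151) is the momentum-
space analogue), and `|K(∅)|` for `m = 0`. [cite: Salmhofer1998, §4.1 (norm before Lemma 1)] -/
def kernelNorm (ε : ℝ) : (m : ℕ) → ((Fin m → Γ) → 𝕜) → ℝ
  | 0, K => ‖K Fin.elim0‖
  | m + 1, K => ⨆ p : Fin (m + 1), ⨆ x : Γ,
      ε ^ m * ∑ X ∈ Finset.univ.filter (fun X : Fin (m + 1) → Γ => X p = x), ‖K X‖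

/-- Unfolding `kernelNorm` in degree `0`. [folklore] -/
theorem kernelNorm_zero_left (ε : ℝ) (K : (Fin 0 → Γ) → 𝕜) : kernelNorm ε 0 K = ‖K Fin.elim0‖ := rfl

/-- Unfolding `kernelNorm` in positive degree. [folklore] -/
theorem kernelNorm_succ (ε : ℝ) (m : ℕ) (K : (Fin (m + 1) → Γ) → 𝕜) :
    kernelNorm ε (m + 1) K = ⨆ p : Fin (m + 1), ⨆ x : Γ,
      ε ^ m * ∑ X ∈ Finset.univ.filter (fun X : Fin (m + 1) → Γ => X p = x), ‖K X‖ := rfl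

/-- The zero kernel has norm `0`. [folklore] -/
theorem kernelNorm_zero_kernel (ε : ℝ) (m : ℕ) : kernelNorm ε m (0 : (Fin m → Γ) → 𝕜) = 0 := by
  cases m with
  | zero => simp [kernelNorm]
  | succ m => simp [kernelNorm]

/-- The kernel norm is nonnegative for a nonnegative weight. [folklore] -/
theorem kernelNorm_nonneg {ε : ℝ} (hε : 0 ≤ ε) (m : ℕ) (K : (Fin m → Γ) → 𝕜) : 0 ≤ kernelNorm ε m K := by
  cases m with
  | zero => exact norm_nonneg _
  | succ m =>
    rw [kernelNorm_succ]
    rcases isEmpty_or_nonempty Γ with hΓ | hΓ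
    · simp
    · exact le_ciSup_of_le (Finite.bddAbove_range _) 0 (le_ciSup_of_le (Finite.bddAbove_range _)
        (Classical.arbitrary Γ) (mul_nonneg (pow_nonneg hε _)
          (Finset.sum_nonneg fun _ _ => norm_nonneg _)))

/-- **Salmhofer's kernels** `G_m = ε^{-m} F_m`: the coefficient functions of `F` w.r.t. the weighted
measure `∫ dX = ε Σ_X`, `F = Σ_m ∫_{Γ^m} dX G_m(X) ψ(X_0)⋯ψ(X_{m-1})` (Salmhofer 1998, (3.12), with
plain instead of Wick-ordered monomials). [cite: Salmhofer1998, §3.2 (3.12)] -/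
def weightedKernel (ε : ℝ) (F : GrassmannAlgebra 𝕜 Γ) (m : ℕ) (X : Fin m → Γ) : 𝕜 :=
  ((ε⁻¹ ^ m : ℝ) : 𝕜) * kernel 𝕜 F m X

omit [Fintype Γ] [DecidableEq Γ] in
/-- Unfolding `weightedKernel`. [folklore] -/
theorem weightedKernel_def (ε : ℝ) (F : GrassmannAlgebra 𝕜 Γ) (m : ℕ) (X : Fin m → Γ) :
    weightedKernel ε F m X = ((ε⁻¹ ^ m : ℝ) : 𝕜) * kernel 𝕜 F m X := rfl

omit [Fintype Γ] [DecidableEq Γ] in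
/-- With unit weight the two kernel conventions agree. [folklore] -/
@[simp] theorem weightedKernel_one (F : GrassmannAlgebra 𝕜 Γ) (m : ℕ) (X : Fin m → Γ) :
    weightedKernel 1 F m X = kernel 𝕜 F m X := by
  simp [weightedKernel]

omit [Fintype Γ] [DecidableEq Γ] in
/-- The zero polynomial has zero weighted kernels. [folklore] -/
@[simp] theorem weightedKernel_zero_right (ε : ℝ) (m : ℕ) (X : Fin m → Γ) :
    weightedKernel ε (0 : GrassmannAlgebra 𝕜 Γ) m X = 0 := by
  simp [weightedKernel]

/-- A **weighted action norm**: `Σ_{m ≤ |Γ|} w(m) · ‖G_m‖`, Salmhofer's `L¹–L^∞` norms (weight `ε`)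
of Salmhofer's kernels `G_m = weightedKernel ε F m` of all degrees of `F`, weighted by `w` (degrees
above `|Γ|` carry no monomials).  With `w m = hᵐ` this is the usual "norm with field weight `h`";
Theorem 1 of Salmhofer 1998 bounds `‖G_{m,r}(t)‖ ≤ γ_{mr} e^{t(m/2-2)}` (`m ≥ 6`), so the
normalising weight at scale `t` is `w m = e^{-t(m/2-2)}`. [folklore] -/
def actionNorm (w : ℕ → ℝ) (ε : ℝ) (F : GrassmannAlgebra 𝕜 Γ) : ℝ :=
  ∑ m ∈ Finset.range (Fintype.card Γ + 1), w m * kernelNorm ε m (weightedKernel ε F m)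

/-- Unfolding `actionNorm`. [folklore] -/
theorem actionNorm_def (w : ℕ → ℝ) (ε : ℝ) (F : GrassmannAlgebra 𝕜 Γ) :
    actionNorm w ε F =
      ∑ m ∈ Finset.range (Fintype.card Γ + 1), w m * kernelNorm ε m (weightedKernel ε F m) :=
  rfl

/-- The zero polynomial has action norm `0`. [folklore] -/
@[simp] theorem actionNorm_zero (w : ℕ → ℝ) (ε : ℝ) : actionNorm w ε (0 : GrassmannAlgebra 𝕜 Γ) = 0 := by
  refine Finset.sum_eq_zero fun m _ => ?_
  rw [show weightedKernel ε (0 : GrassmannAlgebra 𝕜 Γ) m = 0 from funext fun X => weightedKernel_zero_right ε m X,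
    kernelNorm_zero_kernel, mul_zero]

end Norms

end Literature.MathematicalPhysics.QuantumLattice
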